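/-
Copyright (c) 2026 the pub-hodgecm-mathlib formalisation cell (harness21).  Prover seat hodgecm-mathlib-K2Liu-p11 (g0): Track B «K2-LIT»,
#184♮ = hLiu418 = stmt-HodgeConjecture-24832; Road I v3 organ U3, file U3-fin (C): the finite-index coset data of a finite-adelic translate for a STANDARD
Iwasawa datum (discharge of the `(K′, T)` binders of ★ U3-fin (B)); SIGS-RoadI-v3 v3.4 §U3.3.
-/
import Literature.NumberTheory.K2Lit.SiegelStandardIwasawaData                  -- ★ `IwasawaDatum.IsStd` (standard data: `K = C_∞ · C_f`, `C_f` open)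
import Summits.HodgeConjecture.HodgeConjecture.Theorems.K2LiuStdFamilyFactorisablePrelims   -- ★ #31s kit: `archPart_mul'∕_inv'`, `finPart_mul'∕_inv'∕_one'` on `↥HA`-typed arguments
import Mathlib.Topology.Algebra.OpenSubgroup                                     -- `Subgroup.quotient_finite_of_isOpen`
import HarnessLib

/-!
# Crux `HLiu418`, road `K2_Liu`, Road I v3 organ U3, file U3-fin (C): FINITE-INDEX COSET DATA `(K′, T)` OF A FINITE-ADELIC TRANSLATE

Cell `hodgecm-mathlib`, crux item hLiu418 = `stmt-HodgeConjecture-24832`; squad K2 ∕ K2Liu, LEAD F0P6-plan (g12), road-map owner K2E5-plan (g5), prover K2Liu-p11 (g0).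
THEOREMS ONLY (no `def`, no instance, no notation, no named-fact hypothesis, no `sorry`); lane `--supports stmt-HodgeConjecture-24832 --as helper` (count-neutral).

★ U3-fin (B) `K2LiuResidueMapEquivariantFin.resGen_twistedStdExtension_rightTranslate` takes BY VALUE a subgroup `K′ ≤ K` with `x⁻¹ K′ x ≤ K` and a finite set `T` with
`K = ⋃_{t∈T} t K′`.  For a STANDARD Iwasawa datum (★ `IwasawaDatum.IsStd`: `K = {k | k_∞ ∈ C_∞, k_f ∈ C_f}` with `C_f` OPEN in `H(𝔸_f)`) and a translate `x` with `x_∞ = 1`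
this file PRODUCES them (`exists_cosetData_of_isStd`): `K′ := {k ∈ K | x_f⁻¹ k_f x_f ∈ C_f}` — a subgroup of `K`, stable in the required sense because `(x⁻¹ k′ x)_∞ = k′_∞`
and `(x⁻¹ k′ x)_f = x_f⁻¹ k′_f x_f` — which is OPEN in the COMPACT group `K` (preimage of `C_f` under the continuous `k ↦ x_f⁻¹ k_f x_f`), hence of finite index
(`Subgroup.quotient_finite_of_isOpen`); `T` := a set of coset representatives (`QuotientGroup.mk_out_eq_mul`).
References: [BorelJacquet1979, §4.1]; [PlatonovRapinchuk1994, §5.1]; [Tan1999, §1 p. 166].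
HONEST LABEL: HC_CM is proved only modulo the 7 printed citations (2 remaining named inputs: hLiu418 = stmt-HodgeConjecture-24832,
h413 = stmt-HodgeConjecture-24833) until rung 0 closes; count-neutral helper, closes no socket.
-/

set_option autoImplicit false
set_option linter.dupNamespace false

noncomputable section

open scoped Matrix Topology
open Filter NumberField IsDedekindDomain
open Literature.NumberTheory.Automorphic Literature.NumberTheory.GaloisRepresentations
open Literature.NumberTheory.GelbartRogawski1991 Literature.NumberTheory.GelbartRogawski1991.GRConstruction
open Literature.NumberTheory.K2Lit.SiegelDoubled
open Summit.HodgeConjecture.HodgeConjecture.Cruxes.HLiu418.K2LiuStdFamilyFactorisable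

namespace Summit.HodgeConjecture.HodgeConjecture.Cruxes.HLiu418.K2LiuResidueMapEquivariantFinCosets

variable (L : Type) [Field L] [NumberField L] [IsCMField L]
variable {N M n : ℕ} (e : Fin N × Fin M ≃ Fin n)
  (dV : Fin N → L) (hdV : ∀ i, IsCMField.complexConj L (dV i) = dV i)
  (dW : Fin M → L) (hdW : ∀ i, IsCMField.complexConj L (dW i) = dW i)

/-- **FINITE-INDEX COSET DATA OF A FINITE-ADELIC TRANSLATE** (the `(K′, T)` binders of ★ U3-fin (B), discharged for STANDARD data): for `𝒦` standard and `x ∈ H(𝔸)` with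
`x_∞ = 1` there are a subgroup `K′ ≤ K` with `x⁻¹ K′ x ≤ K` and a finite `T ⊆ H(𝔸)` with `K ⊆ ⋃_{t∈T} t K′`.
[cite: BorelJacquet1979, §4.1] [cite: PlatonovRapinchuk1994, §5.1] [cite: Tan1999, §1 p. 166] -/
theorem exists_cosetData_of_isStd (𝒦 : IwasawaDatum L e dV hdV dW hdW) (h𝒦 : 𝒦.IsStd) (x : HA L e dV hdV dW hdW)
    (hx : UnitaryGroup.archPart (Fp L) L (IsCMField.complexConj L) (n + n) (hermD L e dV hdV dW hdW) x = 1) :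
    ∃ (K' : Subgroup (HA L e dV hdV dW hdW)) (T : Finset (HA L e dV hdV dW hdW)),
      K' ≤ 𝒦.K ∧ (∀ k' ∈ K', x⁻¹ * k' * x ∈ 𝒦.K) ∧ (∀ k ∈ 𝒦.K, ∃ t ∈ T, ∃ k' ∈ K', k = t * k') := by
  classical
  obtain ⟨Cinf, Cfin, S, hmem, hopen, -, -⟩ := h𝒦
  -- the finite component of `x` and the conjugated condition
  set xf := UnitaryGroup.finPart (Fp L) L (IsCMField.complexConj L) (n + n) (hermD L e dV hdV dW hdW) x with hxf
  -- `K′ := {k ∈ K | x_f⁻¹ k_f x_f ∈ C_f}` as a subgroup of `H(𝔸)`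
  let K' : Subgroup (HA L e dV hdV dW hdW) :=
    { carrier := {k | k ∈ 𝒦.K ∧ xf⁻¹ * UnitaryGroup.finPart (Fp L) L (IsCMField.complexConj L) (n + n) (hermD L e dV hdV dW hdW) k * xf ∈ Cfin}
      mul_mem' := by
        rintro a b ⟨ha, ha'⟩ ⟨hb, hb'⟩
        refine ⟨𝒦.K.mul_mem ha hb, ?_⟩
        have h1 : xf⁻¹ * UnitaryGroup.finPart (Fp L) L (IsCMField.complexConj L) (n + n) (hermD L e dV hdV dW hdW) (a * b) * xf =
            (xf⁻¹ * UnitaryGroup.finPart (Fp L) L (IsCMField.complexConj L) (n + n) (hermD L e dV hdV dW hdW) a * xf) *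
              (xf⁻¹ * UnitaryGroup.finPart (Fp L) L (IsCMField.complexConj L) (n + n) (hermD L e dV hdV dW hdW) b * xf) := by
          rw [finPart_mul' L e dV hdV dW hdW]; group
        rw [h1]; exact Cfin.mul_mem ha' hb'
      one_mem' := ⟨𝒦.K.one_mem, by rw [finPart_one' L e dV hdV dW hdW, mul_one, inv_mul_cancel]; exact Cfin.one_mem⟩
      inv_mem' := by
        rintro a ⟨ha, ha'⟩
        refine ⟨𝒦.K.inv_mem ha, ?_⟩
        have h1 : xf⁻¹ * UnitaryGroup.finPart (Fp L) L (IsCMField.complexConj L) (n + n) (hermD L e dV hdV dW hdW) (a⁻¹ : HA L e dV hdV dW hdW) * xf =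
            (xf⁻¹ * UnitaryGroup.finPart (Fp L) L (IsCMField.complexConj L) (n + n) (hermD L e dV hdV dW hdW) a * xf)⁻¹ := by
          rw [finPart_inv' L e dV hdV dW hdW]; group
        rw [h1]; exact Cfin.inv_mem ha' }
  have hK'le : K' ≤ 𝒦.K := fun k hk => hk.1
  -- `K′` is open in the compact group `K`, hence of finite index
  haveI : CompactSpace 𝒦.K := isCompact_iff_compactSpace.mp 𝒦.isCompact_K
  have hopen' : IsOpen ((K'.subgroupOf 𝒦.K : Subgroup 𝒦.K) : Set 𝒦.K) := by
    have hc : Continuous fun k : 𝒦.K =>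
        xf⁻¹ * UnitaryGroup.finPart (Fp L) L (IsCMField.complexConj L) (n + n) (hermD L e dV hdV dW hdW) (k : HA L e dV hdV dW hdW) * xf :=
      (continuous_const.mul ((UnitaryGroup.continuous_finPart (Fp L) L (IsCMField.complexConj L) (n + n) (hermD L e dV hdV dW hdW)).comp
        continuous_subtype_val)).mul continuous_const
    have hset : ((K'.subgroupOf 𝒦.K : Subgroup 𝒦.K) : Set 𝒦.K) =
        (fun k : 𝒦.K => xf⁻¹ * UnitaryGroup.finPart (Fp L) L (IsCMField.complexConj L) (n + n) (hermD L e dV hdV dW hdW) (k : HA L e dV hdV dW hdW) * xf) ⁻¹'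
          (Cfin : Set (UnitaryGroup.finAdelic (Fp L) L (IsCMField.complexConj L) (n + n) (hermD L e dV hdV dW hdW))) := by
      ext k
      simp only [SetLike.mem_coe, Subgroup.mem_subgroupOf, Set.mem_preimage]
      exact ⟨fun h => h.2, fun h => ⟨k.2, h⟩⟩
    rw [hset]
    exact hopen.preimage hc
  haveI hfinite : Finite (𝒦.K ⧸ K'.subgroupOf 𝒦.K) := Subgroup.quotient_finite_of_isOpen _ hopen'
  haveI : Fintype (𝒦.K ⧸ K'.subgroupOf 𝒦.K) := Fintype.ofFinite _
  refine ⟨K', (Finset.univ : Finset (𝒦.K ⧸ K'.subgroupOf 𝒦.K)).image fun q => ((Quotient.out q : 𝒦.K) : HA L e dV hdV dW hdW), hK'le, ?_, ?_⟩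
  · -- `x⁻¹ k′ x ∈ K`: archimedean part `k′_∞` (as `x_∞ = 1`), finite part `x_f⁻¹ k′_f x_f ∈ C_f`
    rintro k' ⟨hk', hk'f⟩
    refine (hmem _).2 ⟨?_, ?_⟩
    · rw [archPart_mul' L e dV hdV dW hdW, archPart_mul' L e dV hdV dW hdW, archPart_inv' L e dV hdV dW hdW, hx, inv_one, one_mul, mul_one]
      exact ((hmem k').1 hk').1
    · rw [finPart_mul' L e dV hdV dW hdW, finPart_mul' L e dV hdV dW hdW, finPart_inv' L e dV hdV dW hdW]
      exact hk'f
  · -- coset representatives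
    intro k hk
    obtain ⟨h, hh⟩ := QuotientGroup.mk_out_eq_mul (K'.subgroupOf 𝒦.K) (⟨k, hk⟩ : 𝒦.K)
    refine ⟨((Quotient.out (QuotientGroup.mk (s := K'.subgroupOf 𝒦.K) (⟨k, hk⟩ : 𝒦.K)) : 𝒦.K) : HA L e dV hdV dW hdW),
      Finset.mem_image_of_mem _ (Finset.mem_univ _), ((h : 𝒦.K) : HA L e dV hdV dW hdW)⁻¹, ?_, ?_⟩
    · exact K'.inv_mem ((Subgroup.mem_subgroupOf).1 h.2)
    · have hval := congrArg (fun z : 𝒦.K => (z : HA L e dV hdV dW hdW)) hh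
      simp only [Subgroup.coe_mul] at hval
      rw [hval, mul_inv_cancel_right]

end Summit.HodgeConjecture.HodgeConjecture.Cruxes.HLiu418.K2LiuResidueMapEquivariantFinCosets

end
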